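import Mathlib
import HarnessLib
import Summits.HubbardSuperconductivity.HubbardSuperconductivity.Theorems.KLProgrammeKLRegimeEngineGridLitPkgOfIncrements

/-!
# Route `KLProgramme` — ENGINE (stmt-HubbardSuperconductivity-20437 `KLRegimeEngineV17F2`), row (b) `stub_engine_step_norms`, binder #7 `hincr`:
# the MOMENT-ONLY telescope of the grid two-leg atom and the `hexG` package from LOCAL-BLIND increment masses — cure (α′) of the located
# candidate «(b)-HINCR-TADPOLE» (cell gate-hubbard-kl, seat hubbard-kl-k3c2-p2 g30, E1-LEDGER custodian; evidence #52 on 20437)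

WHY.  `…TwoLegGridMomentsTelescope` §3/§4 dominate the atom's two first-moment weights (`(β/N)·circDist`, `[x⃗₁ ≠ x⃗₀](1+|Δx̃₀|+|Δx̃₁|)`, both
vanishing on a LOCAL string) by `Λ_j⁻¹·klScaleWt_j = Λ_j⁻¹·(1 + Λ_j·diam)`, so the increment hypothesis of `twoLegGridMomentsAt_of_wtIncrements` —
and the producer binder `hincr` of `exists_gridLitPkg_of_wtIncrements` keyed on it — charges the PLAIN pinned mass of the two-leg slice increments in
`U²`-currency with a `U`-blind summed budget `Bw`.  The plain mass contains the first-order slice tadpole `U·ε·ΔC_j(p,p)` (`|ΔC_j(p,p)| ≍ N′(μ)·Λ_j²`,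
nonzero on `klWindowC`), so `hincr` has no model instance (`Bw ≳ 1/U`).  The tree's own sharper domination (docstring of
`timeWeight_le_klScale_inv_mul_klScaleWt`: «indeed `≤ Λ_j⁻¹·(klScaleWt_j − 1) = diam`») removes the `1`:

* §1 `timeWeight_le_labelDiam` (`(β/N)·circDist ≤ diam = Λ_j⁻¹·(klScaleWt_j − 1)`), `offDiagMomentWeight_le_three_mul_labelDiam`
  (`[x⃗₁ ≠ x⃗₀](1+|Δx̃₀|+|Δx̃₁|) ≤ 3·diam`, since the torus site distance is `≥ 1` off the diagonal and dominates each `|Δx̃ᵢ|`), the point-string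
  and pinned-sum forms with the LOCAL-BLIND weight `klScaleWt_j − 1 = Λ_j·diam`;
* §2 `twoLegGridMomentsAt_of_momIncrements[_of_sum_le]` (+ flow-frame forms): base + `(klScaleWt_{j+1} − 1)`-weighted pinned increment masses
  `≤ b j·U²·β/(2N)` with `Σ_{j<n} Λ_{j+1}⁻¹·b j ≤ Bw` ⇒ the atom at `n` with `(Zt₀ + Bw, Zs₀ + 3Bw)`; `twoLegGridMomentsAtC_of_base_momIncrements`;
* §3 **`exists_gridLitPkg_of_momIncrements (hincr')`** ⊢ `∀ P R, P.WF → R.WF2 → ∃ e, IsGridLitPkg R e ∧ TwoLegGridMomentsStepCT P R (klEngQ7 P R) klEngGeo14 …`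
  — EXACTLY `hexG`'s type — from `hincr'` = `hincr` with the single token `klScaleWt … S ↦ (klScaleWt … S − 1)`; package
  `((klZt0 R + Bw, klZs1Base R, klZs20 R + 3Bw), uI ⊓ klGridU₀ R, cI ⊓ 1)`.
By value the new budget is met: `(klScaleWt_{j+1} − 1)`-mass of increment `j` `= Λ_{j+1}·(first moment) ≍ Λ_{j+1}·C·U²·4^{−θj}` ⇒ `Σ_j Λ_{j+1}⁻¹ b j = O(1)`
uniformly in `U` and `n` (BGM 2006 §2.4 (2.36): the `Z_h`/velocity increments) — an E1 hypothesis, not proved here.  Everything in this file is PROVED;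
no definitions; nothing asserts `hincr'`, `hexG`, row (b), any stub of 20437, K3 or superconductivity.
References: BGM 2006 §2.1 (2.4)–(2.5), §2.4 (2.36), §3 (3.2)–(3.8) [cite: BenfattoGiulianiMastropietro2006].
-/

noncomputable section

namespace Summit.HubbardSuperconductivity.HubbardSuperconductivity.Theorems.EngineV8

set_option linter.dupNamespace false -- summit = problem name (single-conjunct summit), D-0017

open Classical
open Real Finset Literature.MathematicalPhysics.QuantumLattice Literature.Probability.LatticeModels
open Literature.Probability.LatticeModels.BattleFederbush GrassmannAlgebra
open Summit.HubbardSuperconductivity.HubbardSuperconductivity.Theorems.KLRegimeSplit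
open Summit.HubbardSuperconductivity.HubbardSuperconductivity.Theorems.KLProgrammeLegKernels

section Model

variable {L M : ℕ} [NeZero L] [NeZero M]

/-! ## §1 The two first-moment weights are dominated by the diameter ALONE (local-blind weight `klScaleWt − 1`) -/

omit [NeZero L] [NeZero M] in
/-- `Λ_j⁻¹·(klScaleWt_j S − 1) = diam S`. -/
theorem klScale_inv_mul_klScaleWt_sub_one (β : ℝ) (j : ℕ) (S : Finset (ZMod (2 * (2 * M)) × TorusSite 2 L)) :
    (klScale klE0 j)⁻¹ * (klScaleWt L M β j S - 1) = labelDiam (gridLabelDist L (2 * (2 * M)) β) S := by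
  rw [klScaleWt_apply, add_sub_cancel_left, ← mul_assoc, inv_mul_cancel₀ (klth_klScale_pos j).ne', one_mul]

omit [NeZero L] [NeZero M] in
/-- The local-blind weight is nonnegative: `0 ≤ klScaleWt_j S − 1`. -/
theorem klScaleWt_sub_one_nonneg (β : ℝ) (j : ℕ) (S : Finset (ZMod (2 * (2 * M)) × TorusSite 2 L)) : 0 ≤ klScaleWt L M β j S - 1 := by
  have := one_le_klScaleWt L M β j S
  linarith

omit [NeZero L] in
/-- **Time weight ≤ diameter**: `(β/N)·circDist_N(j₀, j₁) ≤ Λ_j⁻¹·(klScaleWt_j − 1)` for a grid two-string `Y`. -/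
theorem gridTimeWeight_le_klScale_inv_mul_klScaleWt_sub_one (β : ℝ) (j : ℕ) (Y : Fin 2 → GridLeg (GridPoint L (2 * (2 * M)))) :
    β / ((2 * (2 * M) : ℕ) : ℝ) * (circDist (2 * (2 * M)) (Y 0).1.1.1.val (Y 1).1.1.1.val : ℝ) ≤
      (klScale klE0 j)⁻¹ * (klScaleWt L M β j ((univ.image Y).image gridLegPos) - 1) := by
  haveI : NeZero (2 * (2 * M)) := ⟨by have := NeZero.ne M; omega⟩
  have hd : gridLabelDist L (2 * (2 * M)) β (gridLegPos (Y 0)) (gridLegPos (Y 1)) ≤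
      labelDiam (gridLabelDist L (2 * (2 * M)) β) ((univ.image Y).image gridLegPos) := by
    rw [Finset.image_image]
    exact le_labelDiam _ (mem_image_of_mem _ (mem_univ 0)) (mem_image_of_mem _ (mem_univ 1))
  have ht := timeDist_le_gridLabelDist_gridLegPos (L := L) (N := 2 * (2 * M)) β Y
  rw [klScale_inv_mul_klScaleWt_sub_one]
  exact ht.trans hd

/-- **Off-diagonal space weight ≤ three diameters**: `[x⃗₁ ≠ x⃗₀](1 + |Δx̃₀| + |Δx̃₁|) ≤ 3·Λ_j⁻¹·(klScaleWt_j − 1)` (`0 ≤ β`): off the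
diagonal the torus site distance is `≥ 1` and dominates each `|Δx̃ᵢ|`. -/
theorem gridOffDiagMomentWeight_le_three_mul_klScale_inv_mul_klScaleWt_sub_one {β : ℝ} (hβ : 0 ≤ β) (j : ℕ)
    (Y : Fin 2 → GridLeg (GridPoint L (2 * (2 * M)))) :
    (if (Y 1).1.1.2 - (Y 0).1.1.2 = 0 then (0 : ℝ) else
      (1 + ((((Y 1).1.1.2 - (Y 0).1.1.2) 0).valMinAbs.natAbs : ℝ) + ((((Y 1).1.1.2 - (Y 0).1.1.2) 1).valMinAbs.natAbs : ℝ)) ^ 1) ≤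
      3 * ((klScale klE0 j)⁻¹ * (klScaleWt L M β j ((univ.image Y).image gridLegPos) - 1)) := by
  haveI : NeZero (2 * (2 * M)) := ⟨by have := NeZero.ne M; omega⟩
  have h0 := natAbs_valMinAbs_sub_le_torusSiteDist (Y 0).1.1.2 (Y 1).1.1.2 0
  have h1 := natAbs_valMinAbs_sub_le_torusSiteDist (Y 0).1.1.2 (Y 1).1.1.2 1
  have hd : torusSiteDist (Y 0).1.1.2 (Y 1).1.1.2 ≤ labelDiam (gridLabelDist L (2 * (2 * M)) β) ((univ.image Y).image gridLegPos) := by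
    refine (torusSiteDist_le_gridLabelDist_gridLegPos hβ Y).trans ?_
    rw [Finset.image_image]
    exact le_labelDiam _ (mem_image_of_mem _ (mem_univ 0)) (mem_image_of_mem _ (mem_univ 1))
  have hD0 : 0 ≤ labelDiam (gridLabelDist L (2 * (2 * M)) β) ((univ.image Y).image gridLegPos) := labelDiam_nonneg _ _
  rw [klScale_inv_mul_klScaleWt_sub_one]
  split_ifs with hne
  · positivity
  · -- off the diagonal some coordinate of `x⃗₁ − x⃗₀` is nonzero, so the site distance is at least `1`
    obtain ⟨i, hi⟩ : ∃ i, ((Y 1).1.1.2 - (Y 0).1.1.2) i ≠ 0 := by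
      by_contra hcon
      push Not at hcon
      exact hne (funext hcon)
    have hnat : (((Y 1).1.1.2 - (Y 0).1.1.2) i).valMinAbs.natAbs ≠ 0 := by
      rw [ne_eq, Int.natAbs_eq_zero, ZMod.valMinAbs_eq_zero]
      exact hi
    have h1le : (1 : ℝ) ≤ ((((Y 1).1.1.2 - (Y 0).1.1.2) i).valMinAbs.natAbs : ℝ) := by
      exact_mod_cast Nat.one_le_iff_ne_zero.mpr hnat
    have hi' := natAbs_valMinAbs_sub_le_torusSiteDist (Y 0).1.1.2 (Y 1).1.1.2 i
    rw [pow_one]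
    linarith

omit [NeZero L] in
/-- Point-string form of `gridTimeWeight_le_klScale_inv_mul_klScaleWt_sub_one`. -/
theorem gridTimeWeight_point_le_klScale_inv_mul_klScaleWt_sub_one (β : ℝ) (j : ℕ) (σ : Fin 2) (p₀ p₁ : GridPoint L (2 * (2 * M))) :
    β / ((2 * (2 * M) : ℕ) : ℝ) * (circDist (2 * (2 * M)) p₀.1.val p₁.1.val : ℝ) ≤
      (klScale klE0 j)⁻¹ * (klScaleWt L M β j
        ((univ.image (fun i : Fin 2 => (((![p₀, p₁] i, σ), i) : GridLeg (GridPoint L (2 * (2 * M)))))).image gridLegPos) - 1) := by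
  have h := gridTimeWeight_le_klScale_inv_mul_klScaleWt_sub_one (L := L) (M := M) β j (fun i : Fin 2 => (((![p₀, p₁] i, σ), i)))
  simpa only [Matrix.cons_val_zero, Matrix.cons_val_one, Matrix.cons_val_fin_one] using h

/-- Point-string form of `gridOffDiagMomentWeight_le_three_mul_klScale_inv_mul_klScaleWt_sub_one`. -/
theorem gridOffDiagMomentWeight_point_le_three_mul_klScale_inv_mul_klScaleWt_sub_one {β : ℝ} (hβ : 0 ≤ β) (j : ℕ) (σ : Fin 2)
    (p₀ p₁ : GridPoint L (2 * (2 * M))) :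
    (if p₁.2 - p₀.2 = 0 then (0 : ℝ) else
      (1 + (((p₁.2 - p₀.2) 0).valMinAbs.natAbs : ℝ) + (((p₁.2 - p₀.2) 1).valMinAbs.natAbs : ℝ)) ^ 1) ≤
      3 * ((klScale klE0 j)⁻¹ * (klScaleWt L M β j
        ((univ.image (fun i : Fin 2 => (((![p₀, p₁] i, σ), i) : GridLeg (GridPoint L (2 * (2 * M)))))).image gridLegPos) - 1)) := by
  have h := gridOffDiagMomentWeight_le_three_mul_klScale_inv_mul_klScaleWt_sub_one (L := L) (M := M) hβ j (fun i : Fin 2 => (((![p₀, p₁] i, σ), i)))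
  simpa only [Matrix.cons_val_zero, Matrix.cons_val_one, Matrix.cons_val_fin_one] using h

/-- **TIME ROW FROM A LOCAL-BLIND WEIGHTED PINNED SUM**: for ANY grid element `D`, if
`Σ_{Y : Y 0 = ((p₀,σ),+)} (klScaleWt_j(…) − 1)·‖kernel₂ D Y‖ ≤ B`, then `Σ_{p₁} (β/N)·circDist_N(j₀,j₁)·‖kernel₂ D ((p₀,σ,+),(p₁,σ,−))‖ ≤ Λ_j⁻¹·B`. -/
theorem time_pointSum_le_of_momWt_pinnedSum (β : ℝ) (j : ℕ) (D : GrassmannAlgebra ℂ (GridLeg (GridPoint L (2 * (2 * M)))))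
    (σ : Fin 2) (p₀ : GridPoint L (2 * (2 * M))) {B : ℝ}
    (hB : ∑ Y ∈ univ.filter (fun Y : Fin 2 → GridLeg (GridPoint L (2 * (2 * M))) => Y 0 = ((p₀, σ), 0)),
      (klScaleWt L M β j ((univ.image Y).image gridLegPos) - 1) * ‖kernel ℂ D 2 Y‖ ≤ B) :
    ∑ p₁ : GridPoint L (2 * (2 * M)), β / ((2 * (2 * M) : ℕ) : ℝ) * (circDist (2 * (2 * M)) p₀.1.val p₁.1.val : ℝ) *
        ‖kernel ℂ D 2 (fun i => ((![p₀, p₁] i, σ), i))‖ ≤ (klScale klE0 j)⁻¹ * B := by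
  have hinv : 0 ≤ (klScale klE0 j)⁻¹ := inv_nonneg.2 (klth_klScale_pos j).le
  have hw0 : ∀ Y : Fin 2 → GridLeg (GridPoint L (2 * (2 * M))),
      0 ≤ (klScale klE0 j)⁻¹ * (klScaleWt L M β j ((univ.image Y).image gridLegPos) - 1) :=
    fun Y => mul_nonneg hinv (klScaleWt_sub_one_nonneg β j _)
  calc ∑ p₁ : GridPoint L (2 * (2 * M)), β / ((2 * (2 * M) : ℕ) : ℝ) * (circDist (2 * (2 * M)) p₀.1.val p₁.1.val : ℝ) *
          ‖kernel ℂ D 2 (fun i => ((![p₀, p₁] i, σ), i))‖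
      ≤ ∑ p₁ : GridPoint L (2 * (2 * M)), (klScale klE0 j)⁻¹ * (klScaleWt L M β j
          ((univ.image (fun i : Fin 2 => (((![p₀, p₁] i, σ), i) : GridLeg (GridPoint L (2 * (2 * M)))))).image gridLegPos) - 1) *
          ‖kernel ℂ D 2 (fun i => ((![p₀, p₁] i, σ), i))‖ :=
        sum_le_sum fun p₁ _ => mul_le_mul_of_nonneg_right (gridTimeWeight_point_le_klScale_inv_mul_klScaleWt_sub_one β j σ p₀ p₁) (norm_nonneg _)
    _ ≤ ∑ Y ∈ univ.filter (fun Y : Fin 2 → GridLeg (GridPoint L (2 * (2 * M))) => Y 0 = ((p₀, σ), 0)),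
          (klScale klE0 j)⁻¹ * (klScaleWt L M β j ((univ.image Y).image gridLegPos) - 1) * ‖kernel ℂ D 2 Y‖ :=
        sum_point_string_le_sum_pinned (fun Y => (klScale klE0 j)⁻¹ * (klScaleWt L M β j ((univ.image Y).image gridLegPos) - 1) * ‖kernel ℂ D 2 Y‖)
          (fun Y => mul_nonneg (hw0 Y) (norm_nonneg _)) σ p₀
    _ = (klScale klE0 j)⁻¹ * ∑ Y ∈ univ.filter (fun Y : Fin 2 → GridLeg (GridPoint L (2 * (2 * M))) => Y 0 = ((p₀, σ), 0)),
          (klScaleWt L M β j ((univ.image Y).image gridLegPos) - 1) * ‖kernel ℂ D 2 Y‖ := by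
        rw [mul_sum]
        exact sum_congr rfl fun Y _ => mul_assoc _ _ _
    _ ≤ (klScale klE0 j)⁻¹ * B := mul_le_mul_of_nonneg_left hB hinv

/-- **SPACE ROW FROM A LOCAL-BLIND WEIGHTED PINNED SUM**: the same `(klScaleWt_j − 1)`-weighted pinned sum `≤ B` gives
`Σ_{p₁} [x⃗₁ ≠ x⃗₀](1+|Δx̃₀|+|Δx̃₁|)·‖kernel₂ D ((p₀,σ,+),(p₁,σ,−))‖ ≤ 3Λ_j⁻¹·B` (`0 ≤ β`). -/
theorem offDiag_pointSum_le_of_momWt_pinnedSum {β : ℝ} (hβ : 0 ≤ β) (j : ℕ) (D : GrassmannAlgebra ℂ (GridLeg (GridPoint L (2 * (2 * M)))))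
    (σ : Fin 2) (p₀ : GridPoint L (2 * (2 * M))) {B : ℝ}
    (hB : ∑ Y ∈ univ.filter (fun Y : Fin 2 → GridLeg (GridPoint L (2 * (2 * M))) => Y 0 = ((p₀, σ), 0)),
      (klScaleWt L M β j ((univ.image Y).image gridLegPos) - 1) * ‖kernel ℂ D 2 Y‖ ≤ B) :
    ∑ p₁ : GridPoint L (2 * (2 * M)), (if p₁.2 - p₀.2 = 0 then (0 : ℝ) else
        (1 + (((p₁.2 - p₀.2) 0).valMinAbs.natAbs : ℝ) + (((p₁.2 - p₀.2) 1).valMinAbs.natAbs : ℝ)) ^ 1) *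
        ‖kernel ℂ D 2 (fun i => ((![p₀, p₁] i, σ), i))‖ ≤ 3 * (klScale klE0 j)⁻¹ * B := by
  have hinv : 0 ≤ (klScale klE0 j)⁻¹ := inv_nonneg.2 (klth_klScale_pos j).le
  have hw0 : ∀ Y : Fin 2 → GridLeg (GridPoint L (2 * (2 * M))),
      0 ≤ 3 * ((klScale klE0 j)⁻¹ * (klScaleWt L M β j ((univ.image Y).image gridLegPos) - 1)) :=
    fun Y => mul_nonneg (by norm_num) (mul_nonneg hinv (klScaleWt_sub_one_nonneg β j _))
  calc ∑ p₁ : GridPoint L (2 * (2 * M)), (if p₁.2 - p₀.2 = 0 then (0 : ℝ) else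
          (1 + (((p₁.2 - p₀.2) 0).valMinAbs.natAbs : ℝ) + (((p₁.2 - p₀.2) 1).valMinAbs.natAbs : ℝ)) ^ 1) *
          ‖kernel ℂ D 2 (fun i => ((![p₀, p₁] i, σ), i))‖
      ≤ ∑ p₁ : GridPoint L (2 * (2 * M)), 3 * ((klScale klE0 j)⁻¹ * (klScaleWt L M β j
          ((univ.image (fun i : Fin 2 => (((![p₀, p₁] i, σ), i) : GridLeg (GridPoint L (2 * (2 * M)))))).image gridLegPos) - 1)) *
          ‖kernel ℂ D 2 (fun i => ((![p₀, p₁] i, σ), i))‖ :=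
        sum_le_sum fun p₁ _ => mul_le_mul_of_nonneg_right
          (gridOffDiagMomentWeight_point_le_three_mul_klScale_inv_mul_klScaleWt_sub_one hβ j σ p₀ p₁) (norm_nonneg _)
    _ ≤ ∑ Y ∈ univ.filter (fun Y : Fin 2 → GridLeg (GridPoint L (2 * (2 * M))) => Y 0 = ((p₀, σ), 0)),
          3 * ((klScale klE0 j)⁻¹ * (klScaleWt L M β j ((univ.image Y).image gridLegPos) - 1)) * ‖kernel ℂ D 2 Y‖ :=
        sum_point_string_le_sum_pinned
          (fun Y => 3 * ((klScale klE0 j)⁻¹ * (klScaleWt L M β j ((univ.image Y).image gridLegPos) - 1)) * ‖kernel ℂ D 2 Y‖)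
          (fun Y => mul_nonneg (hw0 Y) (norm_nonneg _)) σ p₀
    _ = 3 * (klScale klE0 j)⁻¹ * ∑ Y ∈ univ.filter (fun Y : Fin 2 → GridLeg (GridPoint L (2 * (2 * M))) => Y 0 = ((p₀, σ), 0)),
          (klScaleWt L M β j ((univ.image Y).image gridLegPos) - 1) * ‖kernel ℂ D 2 Y‖ := by
        rw [mul_sum]
        exact sum_congr rfl fun Y _ => by ring
    _ ≤ 3 * (klScale klE0 j)⁻¹ * B := mul_le_mul_of_nonneg_left hB (mul_nonneg (by norm_num) hinv)

/-! ## §2 The composition from LOCAL-BLIND increment masses -/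

/-- **THE GRID ATOM AT SCALE `n` FROM ITS BASE AND THE LOCAL-BLIND WEIGHTED INCREMENT MASSES** (`0 ≤ β`): base `TwoLegGridMomentsAt … K 0` and, for every
`j < n` and pinned grid leg `w`, `Σ_{Y : Y 0 = w} (klScaleWt L M β (j+1) ((image Y).image gridLegPos) − 1)·‖kernel₂ (W_{j+1}[K] − W_j[K]) Y‖ ≤ b j·U²·β/(2N)` ⇒
`TwoLegGridMomentsAt L M (Zt₀ + Σ_{j<n} Λ_{j+1}⁻¹·b j) (Zs₀ + Σ_{j<n} 3Λ_{j+1}⁻¹·b j) β U μ K n`. [cite: BenfattoGiulianiMastropietro2006, §3 (3.2)-(3.8)] -/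
theorem twoLegGridMomentsAt_of_momIncrements {Zt₀ Zs₀ β U μ : ℝ} {K : TrigPolyC4v} {n : ℕ} (b : ℕ → ℝ) (hβ : 0 ≤ β)
    (h0 : TwoLegGridMomentsAt L M Zt₀ Zs₀ β U μ K 0)
    (hb : ∀ j < n, ∀ w : GridLeg (GridPoint L (2 * (2 * M))),
      ∑ Y ∈ univ.filter (fun Y : Fin 2 → GridLeg (GridPoint L (2 * (2 * M))) => Y 0 = w),
        (klScaleWt L M β (j + 1) ((univ.image Y).image gridLegPos) - 1) *
          ‖kernel ℂ
            (effAction ℂ ((hubbardGridSub L M β (2 * (2 * M))).transpose *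
                hubbardCovAboveCT L M β μ 0 K (klScale klE0 (j + 1)) * hubbardGridSub L M β (2 * (2 * M)))
              (hubbardGridInteraction L (2 * (2 * M)) β U + hubbardGridCounterQuadratic L (2 * (2 * M)) β K) -
            effAction ℂ ((hubbardGridSub L M β (2 * (2 * M))).transpose *
                hubbardCovAboveCT L M β μ 0 K (klScale klE0 j) * hubbardGridSub L M β (2 * (2 * M)))
              (hubbardGridInteraction L (2 * (2 * M)) β U + hubbardGridCounterQuadratic L (2 * (2 * M)) β K)) 2 Y‖ ≤
        b j * U ^ 2 * (β / (2 * ((2 * (2 * M) : ℕ) : ℝ)))) :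
    TwoLegGridMomentsAt L M (Zt₀ + ∑ j ∈ range n, (klScale klE0 (j + 1))⁻¹ * b j)
      (Zs₀ + ∑ j ∈ range n, 3 * (klScale klE0 (j + 1))⁻¹ * b j) β U μ K n := by
  refine twoLegGridMomentsAt_telescope (fun j => (klScale klE0 (j + 1))⁻¹ * b j) (fun j => 3 * (klScale klE0 (j + 1))⁻¹ * b j) hβ h0
    (fun j hj σ p₀ => ?_) (fun j hj σ p₀ => ?_)
  · refine (time_pointSum_le_of_momWt_pinnedSum β (j + 1) _ σ p₀ (hb j hj _)).trans (le_of_eq ?_)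
    ring
  · refine (offDiag_pointSum_le_of_momWt_pinnedSum hβ (j + 1) _ σ p₀ (hb j hj _)).trans (le_of_eq ?_)
    ring

/-- **SUMMED-BUDGET FORM**: as `twoLegGridMomentsAt_of_momIncrements` with `Σ_{j<n} Λ_{j+1}⁻¹·b j ≤ Bw` ⇒ `TwoLegGridMomentsAt L M (Zt₀ + Bw) (Zs₀ + 3Bw) β U μ K n`. -/
theorem twoLegGridMomentsAt_of_momIncrements_of_sum_le {Zt₀ Zs₀ β U μ Bw : ℝ} {K : TrigPolyC4v} {n : ℕ} (b : ℕ → ℝ) (hβ : 0 ≤ β)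
    (h0 : TwoLegGridMomentsAt L M Zt₀ Zs₀ β U μ K 0)
    (hb : ∀ j < n, ∀ w : GridLeg (GridPoint L (2 * (2 * M))),
      ∑ Y ∈ univ.filter (fun Y : Fin 2 → GridLeg (GridPoint L (2 * (2 * M))) => Y 0 = w),
        (klScaleWt L M β (j + 1) ((univ.image Y).image gridLegPos) - 1) *
          ‖kernel ℂ
            (effAction ℂ ((hubbardGridSub L M β (2 * (2 * M))).transpose *
                hubbardCovAboveCT L M β μ 0 K (klScale klE0 (j + 1)) * hubbardGridSub L M β (2 * (2 * M)))
              (hubbardGridInteraction L (2 * (2 * M)) β U + hubbardGridCounterQuadratic L (2 * (2 * M)) β K) -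
            effAction ℂ ((hubbardGridSub L M β (2 * (2 * M))).transpose *
                hubbardCovAboveCT L M β μ 0 K (klScale klE0 j) * hubbardGridSub L M β (2 * (2 * M)))
              (hubbardGridInteraction L (2 * (2 * M)) β U + hubbardGridCounterQuadratic L (2 * (2 * M)) β K)) 2 Y‖ ≤
        b j * U ^ 2 * (β / (2 * ((2 * (2 * M) : ℕ) : ℝ))))
    (hsum : ∑ j ∈ range n, (klScale klE0 (j + 1))⁻¹ * b j ≤ Bw) :
    TwoLegGridMomentsAt L M (Zt₀ + Bw) (Zs₀ + 3 * Bw) β U μ K n := by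
  refine (twoLegGridMomentsAt_of_momIncrements b hβ h0 hb).mono hβ (by linarith) ?_
  have : ∑ j ∈ range n, 3 * (klScale klE0 (j + 1))⁻¹ * b j = 3 * ∑ j ∈ range n, (klScale klE0 (j + 1))⁻¹ * b j := by
    rw [mul_sum]
    exact sum_congr rfl fun j _ => mul_assoc _ _ _
  rw [this]
  linarith

/-- **FLOW-FRAME FORM** of `twoLegGridMomentsAt_of_momIncrements_of_sum_le` (`K := klFlowFrameU … n`): base at `(K_n, 0)` + local-blind increment masses at `K_n`
with `Σ_{j<n} Λ_{j+1}⁻¹·b j ≤ Bw` ⇒ `TwoLegGridFlowMomentsAt L M (Zt₀ + Bw) (Zs₀ + 3Bw) β U μ n`. -/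
theorem twoLegGridFlowMomentsAt_of_momIncrements_of_sum_le {Zt₀ Zs₀ β U μ Bw : ℝ} {n : ℕ} (b : ℕ → ℝ) (hβ : 0 ≤ β)
    (h0 : TwoLegGridMomentsAt L M Zt₀ Zs₀ β U μ (klFlowFrameU L M β U μ n) 0)
    (hb : ∀ j < n, ∀ w : GridLeg (GridPoint L (2 * (2 * M))),
      ∑ Y ∈ univ.filter (fun Y : Fin 2 → GridLeg (GridPoint L (2 * (2 * M))) => Y 0 = w),
        (klScaleWt L M β (j + 1) ((univ.image Y).image gridLegPos) - 1) *
          ‖kernel ℂ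
            (effAction ℂ ((hubbardGridSub L M β (2 * (2 * M))).transpose *
                hubbardCovAboveCT L M β μ 0 (klFlowFrameU L M β U μ n) (klScale klE0 (j + 1)) * hubbardGridSub L M β (2 * (2 * M)))
              (hubbardGridInteraction L (2 * (2 * M)) β U + hubbardGridCounterQuadratic L (2 * (2 * M)) β (klFlowFrameU L M β U μ n)) -
            effAction ℂ ((hubbardGridSub L M β (2 * (2 * M))).transpose *
                hubbardCovAboveCT L M β μ 0 (klFlowFrameU L M β U μ n) (klScale klE0 j) * hubbardGridSub L M β (2 * (2 * M)))
              (hubbardGridInteraction L (2 * (2 * M)) β U + hubbardGridCounterQuadratic L (2 * (2 * M)) β (klFlowFrameU L M β U μ n))) 2 Y‖ ≤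
        b j * U ^ 2 * (β / (2 * ((2 * (2 * M) : ℕ) : ℝ))))
    (hsum : ∑ j ∈ range n, (klScale klE0 (j + 1))⁻¹ * b j ≤ Bw) :
    TwoLegGridFlowMomentsAt L M (Zt₀ + Bw) (Zs₀ + 3 * Bw) β U μ n :=
  twoLegGridMomentsAt_of_momIncrements_of_sum_le b hβ h0 hb hsum

/-- **THE C-TELESCOPE FROM LOCAL-BLIND MASSES**: base C-atom `(Zt₀, Zs₁, Zs₂)` at `(K, 0)` + `(klScaleWt_{j+1} − 1)`-weighted pinned increment masses `b j`
with `Σ_{j<n} Λ_{j+1}⁻¹·b j ≤ Bw` ⇒ C-atom `(Zt₀ + Bw, Zs₁, Zs₂ + 3Bw)` at `(K, n)` (`0 ≤ β`, `U ≠ 0`). [cite: BenfattoGiulianiMastropietro2006, §3 (3.2)-(3.8)] -/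
theorem twoLegGridMomentsAtC_of_base_momIncrements {Zt₀ Zs₁ Zs₂ c β U μ Bw : ℝ} {K : TrigPolyC4v} {n : ℕ} (b : ℕ → ℝ) (hβ : 0 ≤ β) (hU : U ≠ 0)
    (h0 : TwoLegGridMomentsAtC L M Zt₀ Zs₁ Zs₂ c β U μ K 0)
    (hb : ∀ j < n, ∀ w : GridLeg (GridPoint L (2 * (2 * M))),
      ∑ Y ∈ univ.filter (fun Y : Fin 2 → GridLeg (GridPoint L (2 * (2 * M))) => Y 0 = w),
        (klScaleWt L M β (j + 1) ((univ.image Y).image gridLegPos) - 1) *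
          ‖kernel ℂ
            (effAction ℂ ((hubbardGridSub L M β (2 * (2 * M))).transpose *
                hubbardCovAboveCT L M β μ 0 K (klScale klE0 (j + 1)) * hubbardGridSub L M β (2 * (2 * M)))
              (hubbardGridInteraction L (2 * (2 * M)) β U + hubbardGridCounterQuadratic L (2 * (2 * M)) β K) -
            effAction ℂ ((hubbardGridSub L M β (2 * (2 * M))).transpose *
                hubbardCovAboveCT L M β μ 0 K (klScale klE0 j) * hubbardGridSub L M β (2 * (2 * M)))
              (hubbardGridInteraction L (2 * (2 * M)) β U + hubbardGridCounterQuadratic L (2 * (2 * M)) β K)) 2 Y‖ ≤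
        b j * U ^ 2 * (β / (2 * ((2 * (2 * M) : ℕ) : ℝ))))
    (hsum : ∑ j ∈ range n, (klScale klE0 (j + 1))⁻¹ * b j ≤ Bw) :
    TwoLegGridMomentsAtC L M (Zt₀ + Bw) Zs₁ (Zs₂ + 3 * Bw) c β U μ K n := by
  have h := twoLegGridMomentsAt_of_momIncrements_of_sum_le b hβ (h0.toMomentsAt hU) hb hsum
  refine TwoLegGridMomentsAt.toC_of_split (h.mono hβ le_rfl (le_of_eq ?_)) hU
  ring

end Model

/-! ## §3 The `hexG` package from the LOCAL-BLIND E1 increment family `hincr'` -/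

/-- **THE `hexG` PACKAGE OF ROW (b) FROM THE LOCAL-BLIND INCREMENT FAMILY — BY TYPE**: `hincr'` = `hincr` of `exists_gridLitPkg_of_wtIncrements` with the
single token `klScaleWt … S ↦ (klScaleWt … S − 1)` (the first-order slice tadpole, a local string, is no longer charged); conclusion = EXACTLY the type of
`hexG` in `A24a1G14.stub_engine_step_norms_of_E1rows`, package `((klZt0 R + Bw, klZs1Base R, klZs20 R + 3Bw), uI ⊓ klGridU₀ R, cI ⊓ 1)`.
[cite: BenfattoGiulianiMastropietro2006, §2.1 (2.4)-(2.5), §2.4 (2.36), §3 (3.2)-(3.8)] -/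
theorem exists_gridLitPkg_of_momIncrements
    (hincr' : ∀ (P : SplitConsts) (R : RenConsts), P.WF → R.WF2 →
      ∃ Bw : ℝ, 0 ≤ Bw ∧ ∃ uI : EngConsts → ℝ → ℝ, (∀ Q cc, 0 < uI Q cc) ∧ ∃ cI : ℝ, 0 < cI ∧
      ∀ Q : EngConsts, (klEngQ7 P R).IsRaiseOf Q →
      ∀ cc : ℝ, 0 < cc → cc ≤ klEngC₃6 P R → cc ≤ cI →
      ∀ μ ∈ klWindowC, ∀ U : ℝ, 0 < U → U ≤ klEngU₀10 P R cc → U ≤ uI Q cc →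
      ∀ β : ℝ, klBetaMin ≤ β → β ≤ Real.exp (cc / U ^ 2) →
      ∀ (L M : ℕ) [NeZero L] [NeZero M], klEngL₄ P R β U ≤ L → klEngM₃ β U L ≤ M →
      ∀ n : ℕ, 1 ≤ n → n ≤ nScales β + 1 →
        HistP klPredsV17F2 L M klEngGeo14 P Q R β U μ 0 n → FrameOK R U (nScales β) μ (klFlowFrameU L M β U μ n) →
        ∃ b : ℕ → ℝ, (∑ j ∈ range n, (klScale klE0 (j + 1))⁻¹ * b j ≤ Bw) ∧
          ∀ j < n, ∀ w : GridLeg (GridPoint L (2 * (2 * M))),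
            ∑ Y ∈ univ.filter (fun Y : Fin 2 → GridLeg (GridPoint L (2 * (2 * M))) => Y 0 = w),
              (klScaleWt L M β (j + 1) ((univ.image Y).image gridLegPos) - 1) *
                ‖kernel ℂ
                  (effAction ℂ ((hubbardGridSub L M β (2 * (2 * M))).transpose *
                      hubbardCovAboveCT L M β μ 0 (klFlowFrameU L M β U μ n) (klScale klE0 (j + 1)) * hubbardGridSub L M β (2 * (2 * M)))
                    (hubbardGridInteraction L (2 * (2 * M)) β U + hubbardGridCounterQuadratic L (2 * (2 * M)) β (klFlowFrameU L M β U μ n)) -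
                  effAction ℂ ((hubbardGridSub L M β (2 * (2 * M))).transpose *
                      hubbardCovAboveCT L M β μ 0 (klFlowFrameU L M β U μ n) (klScale klE0 j) * hubbardGridSub L M β (2 * (2 * M)))
                    (hubbardGridInteraction L (2 * (2 * M)) β U + hubbardGridCounterQuadratic L (2 * (2 * M)) β (klFlowFrameU L M β U μ n))) 2 Y‖ ≤
              b j * U ^ 2 * (β / (2 * ((2 * (2 * M) : ℕ) : ℝ)))) :
    ∀ (P : SplitConsts) (R : RenConsts), P.WF → R.WF2 →
      ∃ e : (ℝ × ℝ × ℝ) × (EngConsts → ℝ → ℝ) × ℝ, IsGridLitPkg R e ∧ TwoLegGridMomentsStepCT P R (klEngQ7 P R) klEngGeo14 e.1 e.2.1 e.2.2 := by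
  intro P R hP hR
  obtain ⟨Bw, hBw, uI, huI, cI, hcI, h⟩ := hincr' P R hP hR
  have hRW : R.WF := hR.1
  obtain ⟨hZt, hZs⟩ := klZBase0_le_klZ0 hRW
  refine ⟨((klZt0 R + Bw, klZs1Base R, klZs20 R + 3 * Bw), fun Q cc => min (uI Q cc) (klGridU₀ R), min cI 1),
    ⟨by simp only; linarith, klZs1Base_nonneg hRW, by simp only; linarith, fun Q cc => lt_min (huI Q cc) (klGridU₀_pos hRW), lt_min hcI one_pos⟩, ?_⟩
  intro Q hQ cc hcc hcc6 hccG μ hμ U hU hU10 hUu β hβ hβc L M _ _ hL hM n hn1 hn hhist hfr _ _ _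
  have hccI : cc ≤ cI := hccG.trans (min_le_left _ _)
  have hcc1 : cc ≤ 1 := hccG.trans (min_le_right _ _)
  have hUI : U ≤ uI Q cc := hUu.trans (min_le_left _ _)
  have hUg : U ≤ klGridU₀ R := hUu.trans (min_le_right _ _)
  have hU1 : U ≤ 1 := le_one_of_le_klEngU₀3 (hU10.trans (klEngU₀10_le_klEngU₀3 P R cc))
  have hU1' : |U| ≤ 1 := by rwa [abs_of_pos hU]
  have hβ0 : 0 < β := pos_of_klBetaMin_le hβ
  have hlog : 1 ≤ Real.log 4 := by
    have := Real.add_one_le_exp (1 : ℝ)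
    rw [← Real.log_exp 1]
    exact Real.log_le_log (Real.exp_pos 1) (by linarith [Real.exp_one_lt_d9])
  have hc1 : cc / Real.log 4 ≤ 1 := by
    rw [div_le_one (by linarith)]
    exact hcc1.trans hlog
  have hN : (((nScales β : ℕ) : ℝ) + 1) * U ^ 2 ≤ cc / Real.log 4 := nScales_succ_mul_sq_le hcc.le hβ hβc
  have hL3 : klEngL₃ β U ≤ L := klEngL₃_le_of_klEngL₄_le hL
  obtain ⟨b, hbs, hb⟩ := h Q hQ cc hcc hcc6 hccI μ hμ U hU hU10 hUI β hβ hβc L M hL hM n hn1 hn hhist hfr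
  have h0 := twoLegGridMomentsAtC_scaleZero_klZ (L := L) (M := M) hfr hRW hU hUg hU1' hN hc1 hβ hL3 hM
  exact twoLegGridMomentsAtC_of_base_momIncrements b hβ0.le hU.ne' h0 hb hbs

end Summit.HubbardSuperconductivity.HubbardSuperconductivity.Theorems.EngineV8

end
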